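import Summits.AtomisticToContinuum.FouriersLaw.Theorems.CageBudgetFeketeUnboundedHeatVarianceCurrentSpectralMeasure
import Summits.AtomisticToContinuum.FouriersLaw.Theorems.CageBudgetFeketeUnboundedHeatVarianceSpectralHeatVarianceUnbounded
import Summits.AtomisticToContinuum.FouriersLaw.Theorems.UnboundedHeatVariance.Negative.BirthNecessity
import Summits.AtomisticToContinuum.FouriersLaw.Theorems.EmbeddedDrudeMourreAbelOfSpectralDensity
import HarnessLib

/-!
# `CageBudgetFekete.UnboundedHeatVariance` — the crux IS its infrared stub, and its Abel form

Support file (`--supports stmt-AtomisticToContinuum-15771`) of the line lead of `birth`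
(`Cruxes/UnboundedHeatVariance/Lines/birth.lean`). With the two provable stubs of the line LANDED
(`stub_currentSpectralMeasure`, S1, Helfand–Bochner representation `C(t) = ∫cos(ωt)dρ`;
`stub_spectralHeatVarianceUnbounded`, S3, Cesàro–Fatou) and the disprover's converse
(`Negative.stub_infraredCurrentSpectrum_of_unboundedHeatVariance`, U ⟹ S2), the crux U is pinned to ONE
statement about ONE finite measure, and to ONE growth statement about the Laplace transform of the summed
current autocorrelation:

* `unboundedHeatVariance_iff_infraredCurrentSpectrum` — **U ⟺ S2** (`stub_infraredCurrentSpectrum`, spelled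
  verbatim): the heat variance is unbounded iff every finite measure representing `C_T` on `t ≥ 0` has an atom
  at `0` or `∫_{ω≠0} ω⁻² dρ = ∞`.
* `infraredCharge_iff_tendsto_integral_inv_sq_add` — for a finite measure `ρ` on `ℝ`:
  `(0 < ρ{0} ∨ ¬Integrable (ω ↦ (ω²)⁻¹) ρ) ⟺ ∫ dρ(ω)/(ν²+ω²) → ∞` as `ν ↓ 0` (monotone convergence both ways).
* `stub_infraredOfAbelDivergence` — the REGISTERED glue stub G of the reshaped line (S2 ↦ S2′ `stub_abelDivergence`):
  Abel divergence of any represented kernel ⟹ infrared charge of every representing measure.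
* `unboundedHeatVariance_iff_abel` — **U ⟺ the ABEL FORM**: in the arena,
  `ν⁻¹ ∫₀^∞ e^{-νt} C_T(t) dt → ∞` as `ν ↓ 0`, i.e. the Abel function `A(ν) = ∫₀^∞ e^{-νt}C_T = ∫ ν/(ν²+ω²)dρ`
  (landed `AbelOfSpectralDensity.integral_exp_neg_mul_cosTransform`) is NOT `O(ν)`; no spectral measure appears in
  the statement. In particular U follows from `liminf_{ν↓0} A(ν) > 0` (any positive Abel–Green–Kubo floor), and
  fails exactly when `A(ν) = O(ν)` (insulating infrared, `[J]` an exact `ℋ₀`-coboundary).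

No definitions; every statement is spelled inline over tree declarations. prover-line-stmt-AtomisticToContinuum-15771-0,
2026-08-17 (cycle 1).
-/

noncomputable section

namespace Summit.AtomisticToContinuum.FouriersLaw.Theorems.UnboundedHeatVariance.Birth

open MeasureTheory Set Filter Topology
open scoped ENNReal
open Literature.MathematicalPhysics.KineticTheory.HeatConduction
open Summit.AtomisticToContinuum.FouriersLaw.Theses

/-! ### 1. U ⟺ S2 -/

/-- **The crux is its infrared stub.** `CageBudgetFekete.UnboundedHeatVariance` holds iff, in the same arena,
every finite measure `ρ` representing the summed current autocorrelation on `t ≥ 0` charges the infrared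
(`0 < ρ{0} ∨ ¬Integrable (ω ↦ (ω²)⁻¹) ρ`) — the statement of the registered stub `stub_infraredCurrentSpectrum`
of line `birth`, verbatim. (⟹: the disprover's `Negative.stub_infraredCurrentSpectrum_of_unboundedHeatVariance`;
⟸: the landed S1 gives `ρ`, S2 its infrared charge, the landed S3 a time beating `R`.) [folklore] -/
theorem unboundedHeatVariance_iff_infraredCurrentSpectrum :
    CageBudgetFekete.UnboundedHeatVariance ↔
    (∀ ω₂ lam β γ : ℝ, 0 < ω₂ → 0 < lam → 0 < β → ∀ T : ℝ, 0 < T → ∀ μ : MeasureTheory.Measure Literature.MathematicalPhysics.KineticTheory.HeatConduction.ChainConfig, (Literature.MathematicalPhysics.KineticTheory.HeatConduction.pinnedChain ω₂ lam β γ).IsChainGibbsMeasure T μ → Literature.MathematicalPhysics.KineticTheory.HeatConduction.IsShiftInvariant μ → μ.map (fun σ : Literature.MathematicalPhysics.KineticTheory.HeatConduction.ChainConfig => fun x : ℤ => ((σ x).1, -(σ x).2)) = μ → ∀ D : Literature.MathematicalPhysics.KineticTheory.HeatConduction.InfiniteChainDynamics (Literature.MathematicalPhysics.KineticTheory.HeatConduction.pinnedChain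 ω₂ lam β γ), D.PreservesMeasure μ → (∀ t : ℝ, ∀ᵐ σ ∂μ, D.flow t (Literature.MathematicalPhysics.KineticTheory.HeatConduction.shift σ) = Literature.MathematicalPhysics.KineticTheory.HeatConduction.shift (D.flow t σ)) → (∀ t : ℝ, D.HasAbsConvergentCorrelation μ t) → Continuous (fun t : ℝ => D.currentCorrelation μ t) → ∀ ρ : MeasureTheory.Measure ℝ, MeasureTheory.IsFiniteMeasure ρ → (∀ t : ℝ, 0 ≤ t → D.currentCorrelation μ t = ∫ w : ℝ, Real.cos (w * t) ∂ρ) → 0 < ρ {0} ∨ ¬ MeasureTheory.Integrable (fun w : ℝ => (w ^ 2)⁻¹) ρ) := by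
  refine ⟨Negative.stub_infraredCurrentSpectrum_of_unboundedHeatVariance, fun h₂ => ?_⟩
  intro ω₂ lam β γ hω hl hβ T hT μ hG hSI hRefl D hP hShift hAC hCc V hV R
  obtain ⟨ρ, hfin, hrep⟩ :=
    stub_currentSpectralMeasure ω₂ lam β γ hω hl hβ T hT μ hG hSI hRefl D hP hShift hAC hCc
  have hIR := h₂ ω₂ lam β γ hω hl hβ T hT μ hG hSI hRefl D hP hShift hAC hCc ρ hfin hrep
  obtain ⟨τ, hτ0, hRτ⟩ := stub_spectralHeatVarianceUnbounded ρ hfin hIR R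
  refine ⟨τ, hτ0, ?_⟩
  have hint : (∫ s in Set.Ioc (0:ℝ) τ, (τ - s) * D.currentCorrelation μ s) =
      ∫ s in Set.Ioc (0:ℝ) τ, (τ - s) * (∫ w : ℝ, Real.cos (w * s) ∂ρ) :=
    setIntegral_congr_fun measurableSet_Ioc fun s hs => by rw [hrep s hs.1.le]
  rw [hV]
  dsimp only
  rw [hint]
  exact hRτ

/-! ### 2. The infrared charge of a finite measure as divergence of its Poisson integrals -/

/-- `ω ↦ (ν² + ω²)⁻¹` is `ρ`-integrable for `ν ≠ 0` and `ρ` finite (bounded by `(ν²)⁻¹`). [folklore] -/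
theorem integrable_inv_sq_add (ρ : Measure ℝ) [IsFiniteMeasure ρ] {ν : ℝ} (hν : ν ≠ 0) :
    Integrable (fun w : ℝ => (ν ^ 2 + w ^ 2)⁻¹) ρ := by
  refine (integrable_const ((ν ^ 2)⁻¹)).mono' (by fun_prop) (ae_of_all _ fun w => ?_)
  have hν2 : 0 < ν ^ 2 := by positivity
  rw [Real.norm_eq_abs, abs_of_nonneg (by positivity)]
  exact inv_anti₀ hν2 (le_add_of_nonneg_right (sq_nonneg w))

/-- The Poisson integrals `ν ↦ ∫ (ν²+ω²)⁻¹ dρ` are antitone in `ν > 0`. [folklore] -/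
theorem integral_inv_sq_add_antitone (ρ : Measure ℝ) [IsFiniteMeasure ρ] {ν ν' : ℝ} (hν : 0 < ν)
    (hle : ν ≤ ν') :
    ∫ w, (ν' ^ 2 + w ^ 2)⁻¹ ∂ρ ≤ ∫ w, (ν ^ 2 + w ^ 2)⁻¹ ∂ρ := by
  have hν' : 0 < ν' := lt_of_lt_of_le hν hle
  refine integral_mono (integrable_inv_sq_add ρ hν'.ne') (integrable_inv_sq_add ρ hν.ne') fun w => ?_
  have h1 : 0 < ν ^ 2 + w ^ 2 := by positivity
  exact inv_anti₀ h1 (by nlinarith)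

/-- With an atom at `0`, `∫ (ν²+ω²)⁻¹ dρ ≥ ρ{0}·ν⁻²`. [folklore] -/
theorem measureReal_zero_mul_le_integral_inv_sq_add (ρ : Measure ℝ) [IsFiniteMeasure ρ] {ν : ℝ}
    (hν : 0 < ν) : (ρ {0}).toReal * (ν ^ 2)⁻¹ ≤ ∫ w, (ν ^ 2 + w ^ 2)⁻¹ ∂ρ := by
  calc (ρ {0}).toReal * (ν ^ 2)⁻¹ = ∫ w in ({0} : Set ℝ), (ν ^ 2)⁻¹ ∂ρ := by
        rw [setIntegral_const, smul_eq_mul, measureReal_def]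
    _ = ∫ w in ({0} : Set ℝ), (ν ^ 2 + w ^ 2)⁻¹ ∂ρ := by
        refine setIntegral_congr_fun (measurableSet_singleton 0) fun w hw => ?_
        rw [mem_singleton_iff] at hw
        simp [hw]
    _ ≤ ∫ w, (ν ^ 2 + w ^ 2)⁻¹ ∂ρ :=
        setIntegral_le_integral (integrable_inv_sq_add ρ hν.ne') (ae_of_all _ fun w => by positivity)

/-- Without an atom at `0` and with `(ω²)⁻¹ ∈ L¹(ρ)`, the Poisson integrals are bounded:
`∫ (ν²+ω²)⁻¹ dρ ≤ ∫ (ω²)⁻¹ dρ`. [folklore] -/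
theorem integral_inv_sq_add_le_of_integrable (ρ : Measure ℝ) [IsFiniteMeasure ρ] (h0 : ρ {0} = 0)
    (hint : Integrable (fun w : ℝ => (w ^ 2)⁻¹) ρ) {ν : ℝ} (hν : 0 < ν) :
    ∫ w, (ν ^ 2 + w ^ 2)⁻¹ ∂ρ ≤ ∫ w, (w ^ 2)⁻¹ ∂ρ := by
  have hae : ∀ᵐ w ∂ρ, w ≠ 0 := by
    filter_upwards [measure_eq_zero_iff_ae_notMem.1 h0] with w hw
    simpa using hw
  refine integral_mono_ae (integrable_inv_sq_add ρ hν.ne') hint ?_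
  filter_upwards [hae] with w hw
  have h1 : 0 < w ^ 2 := by positivity
  exact inv_anti₀ h1 (le_add_of_nonneg_left (sq_nonneg ν))

/-- If the Poisson integrals stay bounded along `ν = (n+1)⁻¹`, then `(ω²)⁻¹ ∈ L¹(ρ)` (monotone convergence:
`(ν²+ω²)⁻¹ ↑ (ω²)⁻¹` for `ω ≠ 0`, and the value at `ω = 0` of `(ω²)⁻¹` is Lean's `0`). [folklore] -/
theorem integrable_inv_sq_of_bounded (ρ : Measure ℝ) [IsFiniteMeasure ρ] {M : ℝ}
    (hM : ∀ n : ℕ, ∫ w, ((((n:ℝ) + 1)⁻¹) ^ 2 + w ^ 2)⁻¹ ∂ρ ≤ M) :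
    Integrable (fun w : ℝ => (w ^ 2)⁻¹) ρ := by
  set f : ℕ → ℝ → ℝ≥0∞ := fun n w => ENNReal.ofReal (((((n:ℝ) + 1)⁻¹) ^ 2 + w ^ 2)⁻¹) with hf_def
  have hfm : ∀ n, Measurable (f n) := fun n => by
    rw [hf_def]
    fun_prop
  have hmono : Monotone f := by
    intro n m hnm w
    simp only [hf_def]
    refine ENNReal.ofReal_le_ofReal ?_
    have h1 : 0 < (((m:ℝ) + 1)⁻¹) ^ 2 + w ^ 2 := by positivity
    refine inv_anti₀ h1 ?_
    have h2 : ((m:ℝ) + 1)⁻¹ ≤ ((n:ℝ) + 1)⁻¹ := by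
      refine inv_anti₀ (by positivity) ?_
      have : (n:ℝ) ≤ m := by exact_mod_cast hnm
      linarith
    have h3 : 0 ≤ ((m:ℝ) + 1)⁻¹ := by positivity
    nlinarith
  -- each Poisson lintegral is bounded by `M`
  have hbd : ∀ n, ∫⁻ w, f n w ∂ρ ≤ ENNReal.ofReal M := fun n => by
    have hν : ((n:ℝ) + 1)⁻¹ ≠ 0 := by positivity
    rw [hf_def, ← ofReal_integral_eq_lintegral_ofReal (integrable_inv_sq_add ρ hν)
      (ae_of_all _ fun w => by positivity)]
    exact ENNReal.ofReal_le_ofReal (hM n)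
  -- pointwise: `(ω²)⁻¹ ≤ ⨆ n, f n ω`
  have hpt : ∀ w : ℝ, ENNReal.ofReal ((w ^ 2)⁻¹) ≤ ⨆ n, f n w := by
    intro w
    rcases eq_or_ne w 0 with hw | hw
    · simp [hw]
    · have hw2 : w ^ 2 ≠ 0 := pow_ne_zero 2 hw
      have hν : Tendsto (fun n : ℕ => ((n:ℝ) + 1)⁻¹) atTop (𝓝 0) :=
        tendsto_one_div_add_atTop_nhds_zero_nat.congr fun n => one_div _
      have h2 : Tendsto (fun n : ℕ => (((n:ℝ) + 1)⁻¹) ^ 2 + w ^ 2) atTop (𝓝 (0 ^ 2 + w ^ 2)) :=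
        (hν.pow 2).add tendsto_const_nhds
      rw [zero_pow two_ne_zero, zero_add] at h2
      have h3 : Tendsto (fun n : ℕ => f n w) atTop (𝓝 (ENNReal.ofReal ((w ^ 2)⁻¹))) := by
        simp only [hf_def]
        exact ENNReal.tendsto_ofReal (h2.inv₀ hw2)
      exact le_of_tendsto' h3 fun n => le_iSup (fun n => f n w) n
  have hlin : ∫⁻ w, ENNReal.ofReal ((w ^ 2)⁻¹) ∂ρ ≤ ENNReal.ofReal M := by
    calc ∫⁻ w, ENNReal.ofReal ((w ^ 2)⁻¹) ∂ρ ≤ ∫⁻ w, ⨆ n, f n w ∂ρ := lintegral_mono hpt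
      _ = ⨆ n, ∫⁻ w, f n w ∂ρ := lintegral_iSup hfm hmono
      _ ≤ ENNReal.ofReal M := iSup_le hbd
  refine ⟨((measurable_id.pow_const 2).inv).aestronglyMeasurable, ?_⟩
  rw [hasFiniteIntegral_iff_ofReal (ae_of_all _ fun w => by positivity)]
  exact lt_of_le_of_lt hlin ENNReal.ofReal_lt_top

/-- **Infrared charge ⟺ divergence of the Poisson integrals.** For a finite measure `ρ` on `ℝ`:
`0 < ρ{0} ∨ ¬Integrable (ω ↦ (ω²)⁻¹) ρ` iff `∫ (ν²+ω²)⁻¹ dρ(ω) → ∞` as `ν ↓ 0`. (⟹: an atom contributes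
`ρ{0}ν⁻²`; otherwise boundedness along `ν = (n+1)⁻¹` would make `(ω²)⁻¹` integrable by monotone convergence,
and the integrals are antitone in `ν`; ⟸: no atom and integrability cap them by `∫(ω²)⁻¹dρ`.) [folklore] -/
theorem infraredCharge_iff_tendsto_integral_inv_sq_add (ρ : Measure ℝ) [IsFiniteMeasure ρ] :
    (0 < ρ {0} ∨ ¬ Integrable (fun w : ℝ => (w ^ 2)⁻¹) ρ) ↔
      Tendsto (fun ν : ℝ => ∫ w, (ν ^ 2 + w ^ 2)⁻¹ ∂ρ) (𝓝[>] 0) atTop := by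
  constructor
  · intro h
    -- it suffices to beat every `M` at SOME `ν₀ > 0` (antitone in `ν`)
    suffices hsuff : ∀ M : ℝ, ∃ ν₀ : ℝ, 0 < ν₀ ∧ M < ∫ w, (ν₀ ^ 2 + w ^ 2)⁻¹ ∂ρ by
      rw [tendsto_atTop]
      intro M
      obtain ⟨ν₀, hν₀, hM⟩ := hsuff M
      have hmem : Ioo (0:ℝ) ν₀ ∈ 𝓝[>] (0:ℝ) := Ioo_mem_nhdsGT hν₀
      filter_upwards [hmem] with ν hν
      exact hM.le.trans (integral_inv_sq_add_antitone ρ hν.1 hν.2.le)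
    intro M
    rcases h with hatom | hnint
    · -- atom: `ρ{0}·ν⁻² → ∞`
      set c : ℝ := (ρ {0}).toReal with hc_def
      have hc : 0 < c := ENNReal.toReal_pos hatom.ne' (measure_ne_top ρ _)
      -- choose `ν₀` with `ν₀² < c/(|M|+1)`, e.g. `ν₀ = min 1 (c/(|M|+1))`
      set ν₀ : ℝ := min 1 (c / (|M| + 1)) with hν₀_def
      have hM1 : 0 < |M| + 1 := by positivity
      have hν₀pos : 0 < ν₀ := lt_min one_pos (div_pos hc hM1)
      have hν₀le1 : ν₀ ≤ 1 := min_le_left _ _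
      have hν₀le : ν₀ ≤ c / (|M| + 1) := min_le_right _ _
      refine ⟨ν₀, hν₀pos, lt_of_lt_of_le ?_ (measureReal_zero_mul_le_integral_inv_sq_add ρ hν₀pos)⟩
      -- `M < c·ν₀⁻²`: since `ν₀² ≤ ν₀ ≤ c/(|M|+1)`, `c/ν₀² ≥ |M| + 1 > M`
      have hsq : ν₀ ^ 2 ≤ ν₀ := by nlinarith
      have h1 : ν₀ ^ 2 ≤ c / (|M| + 1) := hsq.trans hν₀le
      have h2 : 0 < ν₀ ^ 2 := by positivity
      rw [← hc_def, ← div_eq_mul_inv, lt_div_iff₀ h2]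
      calc M * ν₀ ^ 2 ≤ |M| * ν₀ ^ 2 := mul_le_mul_of_nonneg_right (le_abs_self M) h2.le
        _ < (|M| + 1) * ν₀ ^ 2 := by nlinarith
        _ ≤ (|M| + 1) * (c / (|M| + 1)) := mul_le_mul_of_nonneg_left h1 hM1.le
        _ = c := mul_div_cancel₀ c hM1.ne'
    · -- non-integrable: boundedness along `ν = (n+1)⁻¹` is impossible
      by_contra hcon
      push Not at hcon
      exact hnint (integrable_inv_sq_of_bounded ρ fun n => hcon _ (by positivity))
  · intro h
    by_contra hcon
    push Not at hcon
    obtain ⟨h0', hint⟩ := hcon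
    have h0 : ρ {0} = 0 := le_antisymm h0' bot_le
    have hev : ∀ᶠ ν in 𝓝[>] (0:ℝ), (∫ w, (w ^ 2)⁻¹ ∂ρ) + 1 ≤ ∫ w, (ν ^ 2 + w ^ 2)⁻¹ ∂ρ :=
      (tendsto_atTop.1 h) _
    have hpos : ∀ᶠ ν in 𝓝[>] (0:ℝ), 0 < ν := eventually_mem_nhdsWithin
    obtain ⟨ν, hν1, hν2⟩ := (hev.and hpos).exists
    have := integral_inv_sq_add_le_of_integrable ρ h0 hint hν2
    linarith

/-! ### 3. The Abel function of a represented kernel -/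

/-- **Abel function of a cosine transform, normalised.** If `C(t) = ∫cos(ωt)dρ` for `t ≥ 0` (`ρ` finite) then
for `ν > 0`: `ν⁻¹ ∫_{t>0} e^{-νt} C(t) dt = ∫ (ν²+ω²)⁻¹ dρ(ω)` (landed Fubini/Laplace lemma
`AbelOfSpectralDensity.integral_exp_neg_mul_cosTransform`). [folklore] -/
theorem inv_mul_abel_eq_integral_inv_sq_add (C : ℝ → ℝ) (ρ : Measure ℝ) [IsFiniteMeasure ρ]
    (hrep : ∀ t : ℝ, 0 ≤ t → C t = ∫ w, Real.cos (w * t) ∂ρ) {ν : ℝ} (hν : 0 < ν) :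
    ν⁻¹ * ∫ t in Ioi (0:ℝ), Real.exp (-(ν * t)) * C t = ∫ w, (ν ^ 2 + w ^ 2)⁻¹ ∂ρ := by
  have h1 : (∫ t in Ioi (0:ℝ), Real.exp (-(ν * t)) * C t) =
      ∫ t in Ioi (0:ℝ), Real.exp (-(ν * t)) * ∫ w, Real.cos (w * t) ∂ρ :=
    setIntegral_congr_fun measurableSet_Ioi fun t ht => by rw [hrep t (le_of_lt ht)]
  rw [h1, AbelOfSpectralDensity.integral_exp_neg_mul_cosTransform ρ hν]
  have h2 : (fun w : ℝ => ν / (ν ^ 2 + w ^ 2)) = fun w : ℝ => ν * (ν ^ 2 + w ^ 2)⁻¹ :=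
    funext fun w => div_eq_mul_inv _ _
  rw [h2, integral_const_mul, ← mul_assoc, inv_mul_cancel₀ hν.ne', one_mul]

/-- **G — `stub_infraredOfAbelDivergence` (registered glue stub of line `birth`, reshaping S2 ↦ S2′; pure
real analysis).** For ANY kernel `C` whose normalised Abel function `ν⁻¹∫_{t>0}e^{-νt}C(t)dt` diverges as
`ν ↓ 0`, every finite measure `ρ` representing `C` on `t ≥ 0` charges the infrared
(`0 < ρ{0} ∨ ¬Integrable (ω ↦ (ω²)⁻¹) ρ`): `ν⁻¹A(ν) = ∫(ν²+ω²)⁻¹dρ` (`inv_mul_abel_eq_integral_inv_sq_add`) and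
the infrared dichotomy `infraredCharge_iff_tendsto_integral_inv_sq_add`. [folklore] -/
theorem stub_infraredOfAbelDivergence :
    ∀ C : ℝ → ℝ, Filter.Tendsto (fun ν : ℝ => ν⁻¹ * ∫ t in Set.Ioi (0:ℝ), Real.exp (-(ν * t)) * C t) (nhdsWithin (0:ℝ) (Set.Ioi 0)) Filter.atTop → ∀ ρ : MeasureTheory.Measure ℝ, MeasureTheory.IsFiniteMeasure ρ → (∀ t : ℝ, 0 ≤ t → C t = ∫ w : ℝ, Real.cos (w * t) ∂ρ) → 0 < ρ {0} ∨ ¬ MeasureTheory.Integrable (fun w : ℝ => (w ^ 2)⁻¹) ρ := by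
  intro C hA ρ hfin hrep
  refine (infraredCharge_iff_tendsto_integral_inv_sq_add ρ).2 (hA.congr' ?_)
  filter_upwards [eventually_mem_nhdsWithin] with ν hν
  exact inv_mul_abel_eq_integral_inv_sq_add C ρ hrep hν

/-! ### 4. U ⟺ the Abel form -/

/-- **Abel form of the crux.** `CageBudgetFekete.UnboundedHeatVariance` holds iff, in the same arena, the
normalised Abel function of the summed current autocorrelation diverges at the origin:
`ν⁻¹ ∫_{t>0} e^{-νt} C_T(t) dt → ∞` as `ν ↓ 0` — i.e. `A(ν) = ∫₀^∞ e^{-νt}C_T` is not `O(ν)`. (Both directions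
through the landed Bochner representation S1, `inv_mul_abel_eq_integral_inv_sq_add`, the infrared dichotomy
`infraredCharge_iff_tendsto_integral_inv_sq_add`, and U ⟺ S2.) Consequently any positive Abel–Green–Kubo floor
`liminf_{ν↓0} A(ν) > 0` gives U, and U fails exactly for an insulating infrared `A(ν) = O(ν)`. [folklore] -/
theorem unboundedHeatVariance_iff_abel :
    CageBudgetFekete.UnboundedHeatVariance ↔
    (∀ ω₂ lam β γ : ℝ, 0 < ω₂ → 0 < lam → 0 < β → ∀ T : ℝ, 0 < T →
      ∀ μ : MeasureTheory.Measure ChainConfig,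
        (pinnedChain ω₂ lam β γ).IsChainGibbsMeasure T μ → IsShiftInvariant μ →
        μ.map (fun σ : ChainConfig => fun x : ℤ => ((σ x).1, -(σ x).2)) = μ →
        ∀ D : InfiniteChainDynamics (pinnedChain ω₂ lam β γ), D.PreservesMeasure μ →
          (∀ t : ℝ, ∀ᵐ σ ∂μ, D.flow t (shift σ) = shift (D.flow t σ)) →
          (∀ t : ℝ, D.HasAbsConvergentCorrelation μ t) →
          Continuous (fun t : ℝ => D.currentCorrelation μ t) →
          Tendsto (fun ν : ℝ => ν⁻¹ * ∫ t in Ioi (0:ℝ), Real.exp (-(ν * t)) * D.currentCorrelation μ t)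
            (𝓝[>] 0) atTop) := by
  rw [unboundedHeatVariance_iff_infraredCurrentSpectrum]
  constructor
  · intro h₂ ω₂ lam β γ hω hl hβ T hT μ hG hSI hRefl D hP hShift hAC hCc
    obtain ⟨ρ, hfin, hrep⟩ :=
      stub_currentSpectralMeasure ω₂ lam β γ hω hl hβ T hT μ hG hSI hRefl D hP hShift hAC hCc
    have hIR := h₂ ω₂ lam β γ hω hl hβ T hT μ hG hSI hRefl D hP hShift hAC hCc ρ hfin hrep
    have hP := (infraredCharge_iff_tendsto_integral_inv_sq_add ρ).1 hIR
    refine hP.congr' ?_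
    filter_upwards [eventually_mem_nhdsWithin] with ν hν
    exact (inv_mul_abel_eq_integral_inv_sq_add _ ρ hrep hν).symm
  · intro hA ω₂ lam β γ hω hl hβ T hT μ hG hSI hRefl D hP hShift hAC hCc ρ hfin hrep
    have h := hA ω₂ lam β γ hω hl hβ T hT μ hG hSI hRefl D hP hShift hAC hCc
    refine (infraredCharge_iff_tendsto_integral_inv_sq_add ρ).2 (h.congr' ?_)
    filter_upwards [eventually_mem_nhdsWithin] with ν hν
    exact inv_mul_abel_eq_integral_inv_sq_add _ ρ hrep hν

end Summit.AtomisticToContinuum.FouriersLaw.Theorems.UnboundedHeatVariance.Birth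

end
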